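import Summits.Ventures.QEC.Census.BB.BB784Data
import Summits.Ventures.QEC.Census.BB.BB784RedX
import Summits.Ventures.QEC.Census.RankRREF
import HarnessLib

/-!
# `[[784,24,≤24]]` (BB.bb784): `rank₂ H^X = 380`, chunked masks-only RREF certificate — part s (re-assembly of every check row from the literal reduced rows, `redSelL`)

`BB.bb784` = `QC(x²⁶+y⁶+y⁸, y⁷+x⁹+x²⁰)` on `ℤ₂₈ × ℤ₁₄` [BravyiEtAl2024, §5] (arXiv:2308.07915 chunk p0011 L41–47); rows `BBRows.rowsX la lb`
and pivots `pivX` from `Census/BB/BB784Data.lean`, masks/reduced rows in chunks from `BB784RedX.lean`. Part a: every reduced row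
re-derived from its mask (`masksOKL`, four chunks of 95, `decide +kernel` each) and every check row re-assembled from its pivot bits
(`redSelL`). Parts b/c: unit pivot columns over index ranges (`List.range'` chunks, `decide +kernel` each); part c assembles
`pivotsOK` (`Census/RankPivotChunks.pivotsOK_of_forall`) and the rank (`Census/RankRREFAppend.rank_rowMatrix_of_parts`), transported to
`BB.bb784.HXFlat` along `rowsX_obj`. Tier KERNEL; axioms standard; no `native_decide`. HONEST FRAMING: a rank only.
-/

namespace Summit.Ventures.QEC.Census.BB784

open Matrix Literature.InformationTheory.QuantumCodes Summit.Ventures.QEC.Census BBRows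

/-- Every `H^X` check row is re-assembled from the reduced rows selected by its pivot bits (`redSelL`; ONE `decide +kernel`). -/
theorem selX_ok : ((rowsX la lb).all fun h => redSelL pivX (rX1 ++ rX2 ++ rX3 ++ rX4) h == h) = true := by
  decide +kernel

end Summit.Ventures.QEC.Census.BB784
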